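import Summits.AnomalousDissipation.AnomalousDissipation.Theses.TameRoughRigidity
import Summits.AnomalousDissipation.AnomalousDissipation.Theorems.EnsembleRigidityDefs
import Summits.AnomalousDissipation.AnomalousDissipation.Theorems.TameRoughRigidityGPEulerCoerciveStubFloorDuality
import Summits.AnomalousDissipation.AnomalousDissipation.Theorems.TameRoughRigidityGPEulerCoerciveStubGalerkinTail
import Summits.AnomalousDissipation.AnomalousDissipation.Theorems.TameRoughRigidityGPEulerCoerciveStubGalerkinTailLocal
import Summits.AnomalousDissipation.AnomalousDissipation.Theorems.TameRoughRigidityGPEulerCoerciveFloors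
import HarnessLib

/-!
# Crux `TameRoughRigidity.GPEulerCoercive` (stmt-AnomalousDissipation-18400) — line `floor-duality-galerkin`

N = `GPEulerCoercive`: no Borel probability measure on `H = L²_σ(T³)` is a stationary statistical
solution (FMRT: finite mean enstrophy, cylindrical Liouville identity, shell energy inequality) of the
EULER equations forced by the Galloway–Proctor force `f_GP = sin(2πx₂)e₀ + sin(2πx₀)e₁ + sin(2πx₁)e₂`.

Lead: prover-line-stmt-AnomalousDissipation-18400-0 (2026-08-17): skeleton owned; the four `(d := Fin 3)` named
arguments of the strategist's file respelt as type ascriptions (skeleton-vet SKELVET.md: registered signatures were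
truncated at `:=`), statements otherwise byte-identical.

## Architecture: ENSTROPHY-FLOOR DUALITY + GALERKIN TAIL ABSORPTION (strategist line, 2026-08-17)

The crux is a Liouville-type NON-EXISTENCE statement for measures.  Its linear-programming dual is an
ENSTROPHY FLOOR: every stationary statistics `μ` kills every generator image, `∫ ⟨f − B(v,v), Ψ'(v)⟩ dμ = 0`,
so for ANY cylindrical `Ψ` and level `Γ` the pointwise inequality

  (floor certificate)   `Γ ≤ ‖∇v‖² + ⟨f − B(v,v), Ψ'(v)⟩`   at every finite-enstrophy `v ∈ H`

integrates to `Γ ≤ ∫‖∇v‖² dμ` (W, `stub_floorDuality`).  Hence N follows from an UNBOUNDED family of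
floor certificates (`Γ → ∞`).  The multiplier of the finite-enstrophy hypothesis is the enstrophy
itself (quadratic in the amplitude), so the blind-ray obstruction that killed the parent crux's first
certificate shape (Cruxes/GPStatisticalRigidity/Lines/Sketch.md, "C false above 0.675") does not arise,
and the shell clause is provably idle for N (time reversal: `½(μ + (−)_*μ)` is again an Euler
statistics of `f_GP` with ZERO shell work), so no shell multipliers are needed.

The new move is the GALERKIN/TAIL SPLIT (T, `stub_galerkinTail`): if `Ψ` reads only the Galerkin modes
`P_M v` and its differentials have a uniform pointwise strain bound `S < λ_M := 4π²(M²+1)` (the Stokes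
eigenvalue just above the truncation), then writing `v = y + z`, `y = P_M v`, the unresolved tail `z`
enters `⟨B(v,v), Ψ'(y)⟩` only through `∫⟨(∇Ψ')z,z⟩ + 2∫⟨sym(∇Ψ')y,z⟩ ≥ −S|z|² − 2S|y||z|`, while it pays
`‖∇z‖² ≥ λ_M|z|²`; minimising in `|z|` leaves the penalty `S²|y|²/(λ_M − S)`.  So a level-`Γ` floor
certificate on ALL of `H ∩ {‖∇v‖ < ∞}` follows from a FINITE-DIMENSIONAL inequality on `galerkinSpace M`:

  (Galerkin certificate)  `Γ + S²|y|²/(λ_M − S) ≤ ‖∇y‖² + ⟨f − B(y,y), Ψ'(y)⟩`  for `y ∈ P_M H`.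

The open content is the LADDER (L, `stub_galerkinLadder`): for every `Γ` some resolution `M(Γ)` carries
a Galerkin certificate.  Integrated against any invariant probability measure `ρ` of the `M`-Galerkin
forced Euler system `ẏ = P_M f_GP − P_M B(y,y)` (a complete, divergence-free quadratic ODE on
`galerkinSpace M ≅ ℝⁿ`; the generator term integrates to zero), L says `∫(‖∇y‖² − penalty) dρ ≥ Γ`:
GALERKIN FORCED EULER CANNOT STAY COOL — the minimal mean enstrophy over invariant probability measures
(steady Galerkin dodgers, periodic orbits, invariant tori, SRB-like measures) of the truncated systems
must diverge with the resolution.  By finite-dimensional strong duality for coercive costs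
(Tobasco–Goluskin–Doering, arXiv:1705.07096; the cost `‖∇y‖²` is coercive on `ℝⁿ`, so minimising
sequences of almost-invariant measures are tight) L at level `Γ` is EQUIVALENT, up to the penalty
coupling, to that divergence — a statement about finite-dimensional dynamics whose steady-state
sub-case is the hub's census observable `G_min(K) = 82 → 436` (j020739, K ≤ 14).  The infinite-dimensional
minimax behind the architecture is Bronzi–Mondaini–Rosa 2026 (arXiv:2606.12825, Foias–Prodi stationary
statistical solutions of 3-D NSE, `ν > 0`) / Rosa–Temam (arXiv:2010.06730); at `ν = 0` its V-tightness
step fails (no dissipation inequality, no absorbing ball), which is why only WEAK duality (W) is used and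
the level `Γ` is carried by the enstrophy multiplier.

* `stub_floorDuality` (W, provable now, M): integrate; `∫ gen dμ = 0` by `IsStationaryStatisticalSolution.generator`,
  `∫ ‖∇v‖² dμ = (ensembleEnstrophy μ).toReal` (finite, a.e.-finite density).
* `stub_galerkinTail` (T, provable now, L): Galerkin splitting of the spectral enstrophy
  (`eGradNormSq v = eGradNormSq (P_M v) + eGradNormSq (v − P_M v)`, disjoint Fourier supports), tail
  Poincaré `‖∇z‖² ≥ 4π²(M²+1)|z|²` (`mem_galerkinIndex_iff'`: `k ∉ galerkinIndex M, k ≠ 0 ⇒ |k|² ≥ M²+1`),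
  the strain algebra above, and `Ψ.grad v = Ψ.grad (P_M v)` from the low-mode hypothesis.
* `stub_galerkinTailLocal` (T′, provable now — reshape, cycle 1): T with a state-dependent strain
  budget `S(y)`; the penalty vanishes where `Ψ` is silent.
* `stub_galerkinLadderLocal` (L′, OPEN — the content; reshape of L, cycle 1): the Galerkin certificate
  family for `f_GP` with state-dependent budget (L ⇒ L′; resolution 1 exhausted at exactly 3π, landed
  directly as `stub_gpEulerFloorTools`).
* `GPEulerCoercive_of`: given an Euler statistics `μ` of `f_GP` with mean enstrophy `G < ∞`, take
  `Γ = G + 1`, L′ ⇒ T′ ⇒ W give `G + 1 ≤ G`.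

LANDED SPINE (lead, 2026-08-17; all `--supports` this item, namespace `…Theorems.TameRoughRigidity.GPEulerCoercive`):
W p158422, T p159129, T′ p160903, reduction `N ⇐ ∀Γ L′(Γ)` p161778 (`…Reduction.lean`), the
RUNG-MAKER for linear certificates p170745 (`…LinearRung.lean`: a finite Galerkin PSD certificate for a
fixed test `w` ⇒ `∫(v⊗v):∇w ≥ −‖∇v‖²` on `H` ⇒ every Euler statistics of `f` has mean enstrophy
`≥ (f,w)`), and the first two RUNGS: mean energy `≥ 3/(4π)`, mean enstrophy `≥ 3π` p160461
(`…Floors.lean`) and mean enstrophy `≥ 150/7 ≈ 21.43` p171512 (`…Floor150.lean`, the sibling crux's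
`stub_gpParityForm3` through the rung-maker).  Single-test limit (numerics): `1.5/0.0583 ≈ 25.74`;
resolution `M = 1` of L′ is exhausted at exactly `3π`; beyond the linear-test horizon every rung needs
NONLINEAR cylindrical certificates at `M ≥ 2` — the open stub L′ below, crux-sized.

## References
* C. Foias, O. Manley, R. Rosa, R. Temam, *Navier–Stokes Equations and Turbulence* (CUP 2001), Ch. IV §1.2.
* A. Bronzi, C. Mondaini, R. Rosa, arXiv:2606.12825 (optimal minimax formula, 3-D NSE stationary statistical solutions).
* R. Rosa, R. Temam, arXiv:2010.06730; I. Tobasco, D. Goluskin, C. Doering, arXiv:1705.07096.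
* S. Chernyshenko, P. Goulart, D. Huang, A. Papachristodoulou, Phil. Trans. A 372 (2014) 20130350;
  D. Goluskin, G. Fantuzzi, Nonlinearity 32 (2019) 1705 (SOS auxiliary functionals for PDE truncations + tails).
-/

-- `Summit.<Summit>.<Problem>` is the tree's mandated summit-side namespace (CONVENTIONS §2).
set_option linter.dupNamespace false

noncomputable section

namespace Summit.AnomalousDissipation.AnomalousDissipation.Cruxes.GPEulerCoercive.FloorDualityGalerkin

open MeasureTheory Filter Topology UnitAddTorus
open scoped InnerProductSpace RealInnerProductSpace ENNReal NNReal
open Literature.Analysis.FunctionSpaces Literature.Analysis.FluidPDE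
open Summit.AnomalousDissipation.AnomalousDissipation.Theorems.EnsembleRigidity

/-- Local notation: real vector fields on `T³`. -/
local notation "Vec3" => (UnitAddTorus (Fin 3)) → (EuclideanSpace ℝ (Fin 3))
/-- Local notation: `L²(T³; ℝ³)`. -/
local notation "L2" => (Lp (EuclideanSpace ℝ (Fin 3)) 2 (volume : Measure (UnitAddTorus (Fin 3))))
/-- Local notation: the energy space `H`. -/
local notation "H3" => (Torus.energySpace (Fin 3))

/-! ## Registered stubs -/

/-- **W `stub_floorDuality`** (provable now, M) — WEAK DUALITY FOR THE ENSTROPHY FLOOR.  A stationary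
statistical solution of forced Euler kills every cylindrical generator image
(`IsStationaryStatisticalSolution.generator`: integrable, integral zero) and has the integrable,
a.e.-finite enstrophy density `v ↦ ‖∇v‖²` of integral `(ensembleEnstrophy μ).toReal`; integrating the
pointwise floor certificate `Γ ≤ ‖∇v‖² + ⟨f − B(v,v), Ψ'(v)⟩` (valid at finite-enstrophy `v`, i.e.
`μ`-a.e.) gives `Γ ≤ ∫‖∇v‖² dμ`.  No compactness, no sign of the shell work is used. [folklore] -/
theorem stub_floorDuality (f : Vec3) (μ : Measure H3) (Ψ : Torus.CylindricalTest (Fin 3)) (Γ : ℝ)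
    (hμ : Torus.IsStationaryStatisticalSolution 0 f μ)
    (hcert : ∀ v : H3, Torus.eGradNormSq ((v : L2) : Vec3) ≠ ⊤ →
      Γ ≤ (Torus.eGradNormSq ((v : L2) : Vec3)).toReal + Torus.nsGeneratorPairing 0 f v (Ψ.grad v)) :
    ENNReal.ofReal Γ ≤ Torus.ensembleEnstrophy μ :=
  -- LANDED p158422 (`Theorems/TameRoughRigidityGPEulerCoerciveStubFloorDuality.lean`)
  Summit.AnomalousDissipation.AnomalousDissipation.Theorems.TameRoughRigidity.GPEulerCoercive.stub_floorDuality
    f μ Ψ Γ hμ hcert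

/-- **T `stub_galerkinTail`** (provable now, L) — GALERKIN TAIL ABSORPTION.  Let the cylindrical `Ψ`
read only the Galerkin modes of order `M` (`(v, gᵢ) = (P_M v, gᵢ)` for all `v ∈ L²`, i.e. every test
field `gᵢ` lies in `galerkinSpace M`) and let its differentials `Ψ'(v)` obey the uniform pointwise
strain bound `|⟨∇Ψ'(v)(x) e, e⟩| ≤ S|e|²` with `0 ≤ S < λ_M := 4π²(M² + 1)`.  If the Galerkin
certificate `Γ + S²|y|²/(λ_M − S) ≤ ‖∇y‖² + ⟨f − B(y,y), Ψ'(y)⟩` holds at every `y ∈ H ∩ galerkinSpace M`,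
then the floor certificate `Γ ≤ ‖∇v‖² + ⟨f − B(v,v), Ψ'(v)⟩` holds at every finite-enstrophy `v ∈ H`.
Proof: `v = y + z`, `y = P_M v ∈ H` (`galerkinSpace_le_energySpace_holds`), `Ψ.grad v = Ψ.grad y`;
`‖∇v‖² = ‖∇y‖² + ‖∇z‖²` (disjoint Fourier supports) and `‖∇z‖² ≥ λ_M |z|²` (`mem_galerkinIndex_iff'`);
`⟨B(v,v),w⟩ − ⟨B(y,y),w⟩ = −∫(⟨∇w z,z⟩ + ⟨(∇w + ∇wᵀ) y, z⟩) ≤ S|z|² + 2S|y||z|` (a symmetric `3×3`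
matrix with quadratic form bounded by `S` has operator norm `≤ S`); minimise
`(λ_M − S)t² − 2S|y|t` over `t = |z| ≥ 0`. [folklore] -/
theorem stub_galerkinTail (f : Vec3) (M : ℕ) (Γ S : ℝ) (Ψ : Torus.CylindricalTest (Fin 3))
    (hlow : ∀ (v : L2) (i : Fin Ψ.m),
      Torus.pairing v (Ψ.g i) = Torus.pairing ((Torus.galerkinProj M : L2 →L[ℝ] L2) v) (Ψ.g i))
    (hstrain : ∀ (v : H3) (x : UnitAddTorus (Fin 3)) (e : EuclideanSpace ℝ (Fin 3)),
      |⟪Torus.fderiv (Ψ.grad v) x e, e⟫_ℝ| ≤ S * ‖e‖ ^ 2)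
    (hS : 0 ≤ S) (hSM : S < 4 * Real.pi ^ 2 * ((M : ℝ) ^ 2 + 1))
    (hgal : ∀ y : H3, (y : L2) ∈ (Torus.galerkinSpace M : Submodule ℝ L2) →
      Γ + S ^ 2 * ‖y‖ ^ 2 / (4 * Real.pi ^ 2 * ((M : ℝ) ^ 2 + 1) - S) ≤
        (Torus.eGradNormSq ((y : L2) : Vec3)).toReal + Torus.nsGeneratorPairing 0 f y (Ψ.grad y)) :
    ∀ v : H3, Torus.eGradNormSq ((v : L2) : Vec3) ≠ ⊤ →
      Γ ≤ (Torus.eGradNormSq ((v : L2) : Vec3)).toReal + Torus.nsGeneratorPairing 0 f v (Ψ.grad v) :=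
  -- LANDED p159129 (`Theorems/TameRoughRigidityGPEulerCoerciveStubGalerkinTail.lean`)
  Summit.AnomalousDissipation.AnomalousDissipation.Theorems.TameRoughRigidity.GPEulerCoercive.stub_galerkinTail
    f M Γ S Ψ hlow hstrain hS hSM hgal

/-- **T′ `stub_galerkinTailLocal`** (provable now — RESHAPE of T by the lead, cycle 1) — TAIL
ABSORPTION WITH A STATE-DEPENDENT STRAIN BUDGET.  T charges the tail through one GLOBAL strain bound
`S`, so its Galerkin certificate carries the penalty `S²|y|²/(λ_M − S)` at every Galerkin point — also
far out where a compactly supported `Ψ` is silent, which on the first shell (`‖∇y‖² = 4π²|y|²`) forces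
`S²/(λ_M − S) ≤ 4π²`, i.e. `S ≲ 4π²M`, capping the rungs of resolution `M` linearly in `M`.  The tail
estimate is pointwise in the state, so only the strain `S(y)` of the ONE field `Ψ'(y)` need be paid:
with `|⟨∇Ψ'(v)(x)e,e⟩| ≤ S(v)|e|²`, `0 ≤ S(·) < λ_M`, the certificate
`Γ + S(y)²|y|²/(λ_M − S(y)) ≤ ‖∇y‖² + ⟨f − B(y,y), Ψ'(y)⟩` on `H ∩ galerkinSpace M` lifts to the floor
certificate on all finite-enstrophy fields.  The penalty vanishes where `Ψ` is silent.  Same proof as T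
(landed p160903). [folklore] -/
theorem stub_galerkinTailLocal (f : Vec3) (M : ℕ) (Γ : ℝ) (S : H3 → ℝ)
    (Ψ : Torus.CylindricalTest (Fin 3))
    (hlow : ∀ (v : L2) (i : Fin Ψ.m),
      Torus.pairing v (Ψ.g i) = Torus.pairing ((Torus.galerkinProj M : L2 →L[ℝ] L2) v) (Ψ.g i))
    (hstrain : ∀ (v : H3) (x : UnitAddTorus (Fin 3)) (e : EuclideanSpace ℝ (Fin 3)),
      |⟪Torus.fderiv (Ψ.grad v) x e, e⟫_ℝ| ≤ S v * ‖e‖ ^ 2)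
    (hS : ∀ v : H3, 0 ≤ S v) (hSM : ∀ v : H3, S v < 4 * Real.pi ^ 2 * ((M : ℝ) ^ 2 + 1))
    (hgal : ∀ y : H3, (y : L2) ∈ (Torus.galerkinSpace M : Submodule ℝ L2) →
      Γ + S y ^ 2 * ‖y‖ ^ 2 / (4 * Real.pi ^ 2 * ((M : ℝ) ^ 2 + 1) - S y) ≤
        (Torus.eGradNormSq ((y : L2) : Vec3)).toReal + Torus.nsGeneratorPairing 0 f y (Ψ.grad y)) :
    ∀ v : H3, Torus.eGradNormSq ((v : L2) : Vec3) ≠ ⊤ →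
      Γ ≤ (Torus.eGradNormSq ((v : L2) : Vec3)).toReal + Torus.nsGeneratorPairing 0 f v (Ψ.grad v) :=
  -- LANDED p160903 (`Theorems/TameRoughRigidityGPEulerCoerciveStubGalerkinTailLocal.lean`)
  Summit.AnomalousDissipation.AnomalousDissipation.Theorems.TameRoughRigidity.GPEulerCoercive.stub_galerkinTailLocal
    f M Γ S Ψ hlow hstrain hS hSM hgal

/-- **L′ `stub_galerkinLadderLocal`** (OPEN — the content of the line; RESHAPE of L by the lead,
cycle 1: the strain budget is state-dependent, matching T′; L ⇒ L′ trivially with `S ≡ const`) — THE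
GALERKIN CERTIFICATE LADDER OF `f_GP`.  For every level `Γ` there are a resolution `M`, a budget
`S : H → [0, λ_M)` (`λ_M = 4π²(M²+1)`) and a cylindrical `Ψ` reading only `galerkinSpace M`, whose
differential at each state `v` has pointwise strain `≤ S(v)`, such that
`Γ + S(y)²|y|²/(λ_M − S(y)) ≤ ‖∇y‖² + ⟨f_GP − B(y,y), Ψ'(y)⟩` for all `y ∈ H ∩ galerkinSpace M` — a
finite-dimensional Lyapunov-type inequality for the `M`-Galerkin forced Euler field
`F_M(y) = P_M f_GP − P_M B(y,y)`.  NECESSARY CONDITIONS: (i) at `y = 0`, `(f_GP, Ψ'(0)) ≥ Γ`, whence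
`S(0) ≥ Γ/E₁(M)` with `E₁(M) = sup {(f_GP,h)/strain(h) : h ∈ galerkinSpace M} ≤ √12‖f_GP‖_{Ḣ⁻¹} ≈ 0.675`
(`E₁(1) = 3/(4π)`), so `Γ < λ_M E₁(M)`; (ii) integrating against an invariant probability measure `ρ`
of `ẏ = F_M(y)`: `∫(‖∇y‖² − S(y)²|y|²/(λ_M − S(y))) dρ ≥ Γ` — every steady Galerkin dodger / periodic
orbit / invariant torus of the `M(Γ)`-truncation is hotter than `Γ` ("Galerkin forced Euler cannot stay
cool"; census j020739: `G_min(K) = 82 → 436`, `K = 2 → 14`); (iii) RESOLUTION ONE IS EXHAUSTED AT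
EXACTLY `3π`: on `galerkinSpace 1` the inertial term vanishes identically (`B(y,y) ∈` shell 2), and at
the points `y ⊥ f_GP`, `|y| = r` the inequality reads `Γ ≤ 4π²r² + t − S²r²/(8π² − S)` with
`t = (f_GP, Ψ'(y)) ≤ E₁(1)·S`; minimising over `r` (optimum `r² = 1/(4π)`, `S = 4π²`) gives `Γ ≤ 3π` for
EVERY design — the level already landed directly (`stub_gpEulerFloorTools`: every Euler statistics of
`f_GP` has mean enstrophy `≥ 3π`).  So every rung beyond the landed one needs `M ≥ 2` (shell-2 test
fields, where `E₁(2) ≈ 0.337` and the inertial term is live: a 64-dimensional quadratic field).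
WHY IT MIGHT FAIL: one finite-enstrophy Euler statistics of `f_GP` (N false); a `K`-uniformly cool
family of invariant measures of the truncations escaping as a Reynolds-stress defect at infinity (only
generalised `(μ,σ)`-statistics obstruct: N may survive while L′ dies); a duality gap of the
low-mode/compact-support restriction. -/
theorem stub_galerkinLadderLocal (f : Vec3) (hf : f = gpForce) (Γ : ℝ) :
    ∃ (M : ℕ) (S : H3 → ℝ) (Ψ : Torus.CylindricalTest (Fin 3)),
      (∀ (v : L2) (i : Fin Ψ.m),
        Torus.pairing v (Ψ.g i) = Torus.pairing ((Torus.galerkinProj M : L2 →L[ℝ] L2) v) (Ψ.g i)) ∧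
      (∀ (v : H3) (x : UnitAddTorus (Fin 3)) (e : EuclideanSpace ℝ (Fin 3)),
        |⟪Torus.fderiv (Ψ.grad v) x e, e⟫_ℝ| ≤ S v * ‖e‖ ^ 2) ∧
      (∀ v : H3, 0 ≤ S v) ∧ (∀ v : H3, S v < 4 * Real.pi ^ 2 * ((M : ℝ) ^ 2 + 1)) ∧
      ∀ y : H3, (y : L2) ∈ (Torus.galerkinSpace M : Submodule ℝ L2) →
        Γ + S y ^ 2 * ‖y‖ ^ 2 / (4 * Real.pi ^ 2 * ((M : ℝ) ^ 2 + 1) - S y) ≤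
          (Torus.eGradNormSq ((y : L2) : Vec3)).toReal + Torus.nsGeneratorPairing 0 f y (Ψ.grad y) := by
  sorry

/-! ## The crux -/

/-- **`f_GP` is Euler-coercive in the FMRT class** — the route declaration
`TameRoughRigidity.GPEulerCoercive` (item stmt-AnomalousDissipation-18400), composed from the
registered stubs: a stationary Euler statistics `μ` of `f_GP` has finite mean enstrophy `G`; the
ladder L′ at level `G + 1` gives a Galerkin certificate, the tail lemma T′ makes it a floor certificate
on all finite-enstrophy fields, and weak duality W yields `G + 1 ≤ G`.  (Cycle-1 reshape: T/L with a
global strain budget replaced by T′/L′ with a state-dependent one; T stays landed, L ⇒ L′.) -/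
theorem GPEulerCoercive_of :
    Summit.AnomalousDissipation.AnomalousDissipation.Theses.TameRoughRigidity.GPEulerCoercive := by
  intro f hf μ hμ
  have hf' : f = gpForce := hf.trans gpForce_eq.symm
  -- the mean enstrophy is finite
  have hG : Torus.ensembleEnstrophy μ < ⊤ := hμ.enstrophy_finite
  set G : ℝ≥0∞ := Torus.ensembleEnstrophy μ with hGdef
  -- L′: a Galerkin certificate (state-dependent strain budget) at level G.toReal + 1
  obtain ⟨M, S, Ψ, hlow, hstrain, hS, hSM, hgal⟩ := stub_galerkinLadderLocal f hf' (G.toReal + 1)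
  -- T′: it is a floor certificate on all finite-enstrophy fields
  have hcert := stub_galerkinTailLocal f M (G.toReal + 1) S Ψ hlow hstrain hS hSM hgal
  -- W: integrate against μ
  have hW : ENNReal.ofReal (G.toReal + 1) ≤ G := stub_floorDuality f μ Ψ (G.toReal + 1) hμ hcert
  have hGe : G = ENNReal.ofReal G.toReal := (ENNReal.ofReal_toReal hG.ne).symm
  have hW' : ENNReal.ofReal (G.toReal + 1) ≤ ENNReal.ofReal G.toReal := hW.trans hGe.le
  have h := (ENNReal.ofReal_le_ofReal_iff ENNReal.toReal_nonneg).mp hW'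
  linarith

end Summit.AnomalousDissipation.AnomalousDissipation.Cruxes.GPEulerCoercive.FloorDualityGalerkin

end
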